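import Summits.Ventures.LatticeQCDFlow.Scaling.CompositionDistanceRedraw
import Literature.Probability.MarkovChains.PathCoupling

/-!
HONEST FRAMING: exact (Metropolis-corrected) sampling algorithms for lattice gauge theory; figures
of merit are autocorrelation/cost numbers at stated couplings and volumes; no continuum-physics
claim.

# AdjacentPathBound — THE PRODUCT POTENTIAL `Δ·Φ` DOMINATES THE PATH LENGTH THROUGH ADJACENT COMPOSITIONS: BETWEEN TWO EQUAL-HUB LUMPED STATES THERE IS A CHAIN OF
# `Δ` ONE-PARTICLE REPLACEMENTS (GREEDY: REMOVE THE LIGHTEST SURPLUS PARTICLE OF `X`, ADD THE HEAVIEST SURPLUS PARTICLE OF `Y` FIRST) WHOSE `Φ`-LENGTHS SUM TO AT MOST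
# `Δ(N_X,N_Y)·Φ(x,y)` — THE GEODESIC BOUND OF MEMO-gen37'S PATH-COUPLING REDUCTION (lean-2 GEN-37, ours)

Venture-side (OURS).  Cell `lqcd-flow` (pub-lqcd), unit `pub-lqcd-lean-2-g37`, 2026-08-29.  Chapter W (item 1 (i) at finite swap odds), file 18.  Lumped states `X` (`hub`, `comp`,
`Σ comp = K+1`, `hinj`, `hsurj`, `hhub` as in chapter V file 9 ∕ chapter W file 7); on equal-hub pairs the potential factor is `Φ(x,y) = c(hub) + Σ_v θ_v(comp x + comp y)(v)` (any
hub term `c`, any weights `θ`); EDGES are the ADJACENT equal-hub pairs (`Δ(comp x, comp y) = 1`) with length `Φ`.  THEOREM (`adjacent_path_le`): every equal-hub pair is joined by an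
edge path (`IsGraphPath` of the tree's `PathCoupling`) of `Φ`-length `≤ Δ(comp x, comp y)·Φ(x,y)`.  The step (`adjacent_step_*`): with `a` a surplus content of `x` of MAXIMAL
weight and `b` a surplus content of `y` of MINIMAL weight, `N₁ = N_x − δ_a + δ_b` is a legal composition with the same hub, `Δ(N_x,N₁) = 1`, `Δ(N₁,N_y) = Δ − 1`, and
`Φ(x,x₁) + (Δ−1)Φ(x₁,y) ≤ Δ·Φ(x,y)` because `Δ·(θ_b − θ_a) ≤ M_y − M_x` (the average replacement raises the mass by at least the extreme one).  So the path pseudo-metric of file 17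
generated by `Φ` on adjacent pairs is `≤ Δ·Φ`, which is what makes `Ψ = Δ·Φ` contract along Bubley–Dyer paths.  Hypothesis-equations, no definitions.

## What is proved

* §1 (compositions) `cdist_cast_max`, `cdist_pos_exists_surplus`, `adjacent_step_sum`, `adjacent_step_hub`, `adjacent_step_dist_one`, `adjacent_step_dist_pred`,
  `adjacent_step_mass`, **`adjacent_step_ineq`** (`Δ(θ_b − θ_a) ≤ M' − M` for `a` max-weight surplus, `b` min-weight deficit).
* §2 (states) **`adjacent_path_le`**.

Reading (no numerics implied): combinatorics of compositions.  Literature grade (cell rule): OWN, elementary; nothing cited as a fact; no new bib keys.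
-/

open Finset
open Literature.Probability.MarkovChains

namespace Summit.Ventures.LatticeQCDFlow.Scaling

/-! ## §1 One greedy replacement -/

section Step
variable {S : Type*} [Fintype S] [DecidableEq S] {Δ : (S → ℕ) → (S → ℕ) → ℕ} {θ : S → ℝ}

omit [DecidableEq S] in
/-- `Δ(N,N')` as a real sum of positive parts. [ours] -/
theorem cdist_cast_max (hΔ : ∀ N N', Δ N N' = ∑ v, (N v - N' v)) (N N' : S → ℕ) :
    (Δ N N' : ℝ) = ∑ v, max ((N v : ℝ) - N' v) 0 := by
  rw [hΔ, Nat.cast_sum]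
  refine sum_congr rfl fun v _ => ?_
  rcases le_or_gt (N' v) (N v) with h | h
  · have hr : (N' v : ℝ) ≤ N v := by exact_mod_cast h
    rw [Nat.cast_sub h, max_eq_left (by linarith)]
  · have hr : (N v : ℝ) < N' v := by exact_mod_cast h
    rw [Nat.sub_eq_zero_of_le h.le, max_eq_right (by linarith)]; simp

omit [DecidableEq S] in
/-- A positive distance has a surplus content. [ours] -/
theorem cdist_pos_exists_surplus (hΔ : ∀ N N', Δ N N' = ∑ v, (N v - N' v)) {N N' : S → ℕ} (h : Δ N N' ≠ 0) : ∃ a, N' a < N a := by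
  by_contra hno
  have hno' : ∀ v, N v ≤ N' v := fun v => not_lt.mp fun hv => hno ⟨v, hv⟩
  exact h (by rw [hΔ]; exact sum_eq_zero fun v _ => Nat.sub_eq_zero_of_le (hno' v))

variable {N N' N₁ : S → ℕ} {a b : S}

/-- The replaced composition keeps the total. [ours] -/
theorem adjacent_step_sum (hab : a ≠ b) (ha : N' a < N a) (hN₁ : ∀ v, N₁ v = if v = a then N v - 1 else if v = b then N v + 1 else N v) :
    ∑ v, N₁ v = ∑ v, N v := by
  have hNa : 1 ≤ N a := by omega
  have hz : ∀ v, (N₁ v : ℤ) = (N v : ℤ) - (if v = a then 1 else 0) + (if v = b then 1 else 0) := by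
    intro v; rw [hN₁]
    by_cases hva : v = a
    · subst hva; rw [if_pos rfl, if_pos rfl, if_neg hab]; push_cast [Nat.cast_sub hNa]; ring
    · by_cases hvb : v = b
      · subst hvb; rw [if_neg hva, if_pos rfl, if_neg hva, if_pos rfl]; push_cast; ring
      · rw [if_neg hva, if_neg hvb, if_neg hva, if_neg hvb]; ring
  have h : (∑ v, N₁ v : ℤ) = ∑ v, N v := by
    push_cast
    rw [sum_congr rfl fun v _ => hz v, sum_add_distrib, sum_sub_distrib, Finset.sum_ite_eq' univ a, Finset.sum_ite_eq' univ b]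
    simp
  exact_mod_cast h

omit [Fintype S] in
/-- The hub stays legal (`z` legal in both `N` and `N'`). [ours] -/
theorem adjacent_step_hub (ha : N' a < N a) (hN₁ : ∀ v, N₁ v = if v = a then N v - 1 else if v = b then N v + 1 else N v)
    {z : S} (hz : N z ≠ 0) (hz' : N' z ≠ 0) : N₁ z ≠ 0 := by
  rw [hN₁]; split_ifs with h1 h2
  · subst h1; omega
  · omega
  · exact hz

/-- `Δ(N, N₁) = 1`. [ours] -/
theorem adjacent_step_dist_one (hΔ : ∀ N N', Δ N N' = ∑ v, (N v - N' v)) (hab : a ≠ b) (ha : N' a < N a)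
    (hN₁ : ∀ v, N₁ v = if v = a then N v - 1 else if v = b then N v + 1 else N v) : Δ N N₁ = 1 := by
  rw [hΔ]
  have e : ∀ v, N v - N₁ v = if v = a then 1 else 0 := by
    intro v; rw [hN₁]
    by_cases hva : v = a
    · subst hva; rw [if_pos rfl, if_pos rfl]; omega
    · by_cases hvb : v = b
      · subst hvb; rw [if_neg hva, if_pos rfl, if_neg hva]; omega
      · rw [if_neg hva, if_neg hvb, if_neg hva]; omega
  rw [sum_congr rfl fun v _ => e v, Finset.sum_ite_eq' univ a]; simp

/-- `Δ(N₁, N') = Δ(N, N') − 1` (`a` surplus, `b` deficit). [ours] -/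
theorem adjacent_step_dist_pred (hΔ : ∀ N N', Δ N N' = ∑ v, (N v - N' v)) (hab : a ≠ b) (ha : N' a < N a) (hb : N b < N' b)
    (hN₁ : ∀ v, N₁ v = if v = a then N v - 1 else if v = b then N v + 1 else N v) : Δ N₁ N' + 1 = Δ N N' := by
  rw [hΔ, hΔ]
  have e : ∀ v, (N₁ v - N' v) + (if v = a then 1 else 0) = N v - N' v := by
    intro v; rw [hN₁]
    by_cases hva : v = a
    · subst hva; rw [if_pos rfl, if_pos rfl]; omega
    · by_cases hvb : v = b
      · subst hvb; rw [if_neg hva, if_pos rfl, if_neg hva]; omega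
      · rw [if_neg hva, if_neg hvb, if_neg hva]; omega
  rw [← sum_congr rfl fun v _ => e v, sum_add_distrib, Finset.sum_ite_eq' univ a]; simp

/-- The mass of `N₁`: `M₁ = M − θ_a + θ_b`. [ours] -/
theorem adjacent_step_mass (hab : a ≠ b) (ha : N' a < N a) (hN₁ : ∀ v, N₁ v = if v = a then N v - 1 else if v = b then N v + 1 else N v) :
    ∑ v, θ v * (N₁ v : ℝ) = ∑ v, θ v * (N v : ℝ) - θ a + θ b := by
  have hNa : 1 ≤ N a := by omega
  have hz : ∀ v, θ v * (N₁ v : ℝ) = θ v * (N v : ℝ) - (if v = a then θ a else 0) + (if v = b then θ b else 0) := by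
    intro v; rw [hN₁]
    by_cases hva : v = a
    · subst hva; rw [if_pos rfl, if_pos rfl, if_neg hab]; push_cast [Nat.cast_sub hNa]; ring
    · by_cases hvb : v = b
      · subst hvb; rw [if_neg hva, if_pos rfl, if_neg hva, if_pos rfl]; push_cast; ring
      · rw [if_neg hva, if_neg hvb, if_neg hva, if_neg hvb]; ring
  rw [sum_congr rfl fun v _ => hz v, sum_add_distrib, sum_sub_distrib, Finset.sum_ite_eq' univ a, Finset.sum_ite_eq' univ b]; simp

omit [DecidableEq S] in
/-- **THE GREEDY STEP PAYS:** if `a` is a surplus content of MAXIMAL weight and `b` a deficit content of MINIMAL weight, then `Δ(N,N')·(θ_b − θ_a) ≤ M' − M` (equal totals). [ours] -/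
theorem adjacent_step_ineq (hΔ : ∀ N N', Δ N N' = ∑ v, (N v - N' v)) (hNN' : ∑ v, N v = ∑ v, N' v)
    (hamax : ∀ v, N' v < N v → θ v ≤ θ a) (hbmin : ∀ v, N v < N' v → θ b ≤ θ v) :
    (Δ N N' : ℝ) * (θ b - θ a) ≤ ∑ v, θ v * (N' v : ℝ) - ∑ v, θ v * (N v : ℝ) := by
  have hsym : (Δ N' N : ℝ) = Δ N N' := by exact_mod_cast (cdist_symm_of_sum_eq hΔ hNN').symm
  have hA := cdist_cast_max hΔ N N'
  have hB := cdist_cast_max hΔ N' N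
  -- termwise
  have ht : ∀ v, θ b * max ((N' v : ℝ) - N v) 0 - θ a * max ((N v : ℝ) - N' v) 0 ≤ θ v * (N' v : ℝ) - θ v * (N v : ℝ) := by
    intro v
    rcases lt_trichotomy (N' v) (N v) with h | h | h
    · have hr : (N' v : ℝ) < N v := by exact_mod_cast h
      rw [max_eq_right (by linarith), max_eq_left (by linarith)]; nlinarith [hamax v h]
    · rw [h]; simp
    · have hr : (N v : ℝ) < N' v := by exact_mod_cast h
      rw [max_eq_left (by linarith), max_eq_right (by linarith)]; nlinarith [hbmin v h]
  have hs := sum_le_sum fun v (_ : v ∈ univ) => ht v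
  rw [sum_sub_distrib, ← mul_sum, ← mul_sum, ← hA, ← hB, hsym, sum_sub_distrib] at hs
  linarith

end Step

/-! ## §2 The path of adjacent states -/

section Path
variable {X : Type*} {S : Type*} [Fintype S] [DecidableEq S]
variable {hub : X → S} {comp : X → S → ℕ} {K : ℕ} {θ cz : S → ℝ} {Δ : (S → ℕ) → (S → ℕ) → ℕ} {F : X → X → ℝ}

/-- **EVERY EQUAL-HUB PAIR IS JOINED BY A PATH OF ADJACENT EQUAL-HUB STATES OF `Φ`-LENGTH `≤ Δ·Φ`** (`Φ(x,y) = c(hub) + Σ_vθ_v(comp x + comp y)(v)` on equal-hub pairs). [ours] -/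
theorem adjacent_path_le (hinj : ∀ x x', hub x = hub x' → comp x = comp x' → x = x') (hsum : ∀ x, ∑ v, comp x v = K + 1)
    (hsurj : ∀ (z : S) (N : S → ℕ), ∑ v, N v = K + 1 → N z ≠ 0 → ∃ x, hub x = z ∧ comp x = N) (hhub : ∀ x, comp x (hub x) ≠ 0)
    (hΔ : ∀ N N', Δ N N' = ∑ v, (N v - N' v))
    (hF : ∀ x y, hub x = hub y → F x y = cz (hub x) + ∑ v, θ v * ((comp x v : ℝ) + (comp y v : ℝ))) :
    ∀ x y, hub x = hub y → ∃ L, IsGraphPath (fun x y => hub x = hub y ∧ Δ (comp x) (comp y) = 1) F x y L ∧ L ≤ (Δ (comp x) (comp y) : ℝ) * F x y := by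
  -- induction on the distance, the target `y` fixed
  suffices h : ∀ (D : ℕ) (y x : X), hub x = hub y → Δ (comp x) (comp y) = D →
      ∃ L, IsGraphPath (fun x y => hub x = hub y ∧ Δ (comp x) (comp y) = 1) F x y L ∧ L ≤ (D : ℝ) * F x y by
    intro x y hxy; exact h _ y x hxy rfl
  intro D
  induction D with
  | zero =>
      intro y x hxy hD
      have hc : comp x = comp y := eq_of_cdist_eq_zero hΔ (by rw [hsum, hsum]) hD
      have hx : x = y := hinj x y hxy hc
      subst hx
      exact ⟨0, IsGraphPath.nil x, by simp⟩
  | succ D ih =>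
      intro y x hxy hD
      set N := comp x with hN
      set N' := comp y with hN'
      have hNN' : ∑ v, N v = ∑ v, N' v := by rw [hsum, hsum]
      -- surplus and deficit contents exist
      obtain ⟨a₀, ha₀⟩ := cdist_pos_exists_surplus hΔ (N := N) (N' := N') (by rw [hD]; exact Nat.succ_ne_zero D)
      have hD' : Δ N' N = D + 1 := by rw [← cdist_symm_of_sum_eq hΔ hNN']; exact hD
      obtain ⟨b₀, hb₀⟩ := cdist_pos_exists_surplus hΔ (N := N') (N' := N) (by rw [hD']; exact Nat.succ_ne_zero D)
      -- extremal choices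
      obtain ⟨a, ha, hamax⟩ := exists_max_image (univ.filter fun v => N' v < N v) θ ⟨a₀, by simp [ha₀]⟩
      obtain ⟨b, hb, hbmin⟩ := exists_min_image (univ.filter fun v => N v < N' v) θ ⟨b₀, by simp [hb₀]⟩
      simp only [mem_filter, mem_univ, true_and] at ha hb hamax hbmin
      have hab : a ≠ b := fun e => by subst e; omega
      -- the intermediate composition and state
      set N₁ : S → ℕ := fun v => if v = a then N v - 1 else if v = b then N v + 1 else N v with hN₁def
      have hN₁ : ∀ v, N₁ v = if v = a then N v - 1 else if v = b then N v + 1 else N v := fun v => rfl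
      have hsum₁ : ∑ v, N₁ v = K + 1 := by rw [adjacent_step_sum hab ha hN₁, hN, hsum]
      have hz₁ : N₁ (hub x) ≠ 0 := adjacent_step_hub ha hN₁ (hhub x) (by rw [hxy]; exact hhub y)
      obtain ⟨x₁, hx₁h, hx₁c⟩ := hsurj (hub x) N₁ hsum₁ hz₁
      have h01 : Δ N N₁ = 1 := adjacent_step_dist_one hΔ hab ha hN₁
      have h1y : Δ N₁ N' = D := by have := adjacent_step_dist_pred hΔ hab ha hb hN₁; omega
      -- induction hypothesis from `x₁`
      obtain ⟨L₁, hp₁, hL₁⟩ := ih y x₁ (by rw [hx₁h, hxy]) (by rw [hx₁c]; exact h1y)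
      refine ⟨F x x₁ + L₁, IsGraphPath.cons ⟨hx₁h.symm, by rw [hx₁c]; exact h01⟩ hp₁, ?_⟩
      -- the inequality `F(x,x₁) + D·F(x₁,y) ≤ (D+1)·F(x,y)`
      have hFx1 : F x x₁ = cz (hub x) + ∑ v, θ v * ((N v : ℝ) + (N₁ v : ℝ)) := by rw [hF x x₁ hx₁h.symm, hx₁c]
      have hF1y : F x₁ y = cz (hub x) + ∑ v, θ v * ((N₁ v : ℝ) + (N' v : ℝ)) := by rw [hF x₁ y (by rw [hx₁h, hxy]), hx₁h, hx₁c]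
      have hFxy : F x y = cz (hub x) + ∑ v, θ v * ((N v : ℝ) + (N' v : ℝ)) := hF x y hxy
      have hM₁ := adjacent_step_mass (θ := θ) hab ha hN₁
      have hineq := adjacent_step_ineq hΔ hNN' hamax hbmin
      rw [hD] at hineq
      have split : ∀ (P Q : S → ℕ), ∑ v, θ v * ((P v : ℝ) + (Q v : ℝ)) = ∑ v, θ v * (P v : ℝ) + ∑ v, θ v * (Q v : ℝ) := fun P Q => by
        rw [← sum_add_distrib]; exact sum_congr rfl fun v _ => by ring
      rw [split] at hFx1 hF1y hFxy
      push_cast at hineq ⊢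
      nlinarith [hL₁, hineq, hM₁, hFx1, hF1y, hFxy]

end Path

end Summit.Ventures.LatticeQCDFlow.Scaling
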